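import Literature.NumberTheory.GelbartRogawski1991.LocalSplittingCMFrameNaturality
import Literature.NumberTheory.GelbartRogawski1991.LocalDoubledSwapFrameSiegel
import Literature.NumberTheory.GelbartRogawski1991.LocalSplittingCMBlockRestriction
import Literature.NumberTheory.Automorphic.UnitaryGroupFormCongrFinSum
import HarnessLib

/-!
# The RIGHT-block see-saw for Kudla's CM splitting: `restrictRight (s_{T₁ ⊕ᶠ T₂}) = s_{T₂}` (equal block sizes, diagonal blocks),
# by the block swap `Qᵀ (T₁ ⊕ᶠ T₂) Q = T₂ ⊕ᶠ T₁` and the left see-saw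

Topic `NumberTheory/GelbartRogawski1991`; namespace `Literature.NumberTheory.GelbartRogawski1991.UnitaryDualPair.LocalSplitting`.  KERNEL ONLY:
theorems; no definition, no named fact, no `sorry`, no instance, no notation.  Cell `hodgecm-mathlib` (D-0151), fan B, L1ns road (P) of the crux
hLiu418 — brick E2 (companion of ★ `LocalSplittingCMThetaCentreDoubling`, whose «second block» it identifies); `--supports stmt-HodgeConjecture-24832`,
count-neutral.

★ `DoubledBlock.restrictLeft_localSplittingCMWith` (`LocalSplittingCMBlockRestriction`) is the LEFT see-saw `restrictLeft (s_{T₁ ⊕ᶠ T₂}) = s_{T₁}` of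
Kudla's CM local splittings [Kudla1994, Thm. 3.1: «the splitting determined by `χ` is compatible with the see-saw `U(V₁) × U(V₂) ⊂ U(V₁ ⊥ V₂)`»].
This file derives the RIGHT one for blocks of the same size `n` (so that both orderings live on `Fin (n + n)`):

* §1 (generic `F ⊂ E`) the block swap `Q` (★ `swapQ`, `LocalDoubledSwapFrameSiegel`) is a rational frame `Qᵀ (T₁ ⊕ᶠ T₂) Q = T₂ ⊕ᶠ T₁`
  (`transpose_swapQ_mul_finSum_mul_swapQ`); `Ad(Q)` swaps the `e₂`-blocks (`reindex_coe_frameConj_swapQ'`) and carries `g ⊕ 1` (first block of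
  `T₂ ⊕ᶠ T₁`) to `1 ⊕ g` (second block of `T₁ ⊕ᶠ T₂`) (`frameConj_swapQ_blockSum_inlLoc`).
* §2 **`restrictRight_localSplittingCMWith`** — for `T₁ = diag(t₁)`, `T₂ = diag(t₂)` invertible, `n ≥ 1`, every finite place:
  `restrictRight (localSplittingCMWith ‹T₁ ⊕ᶠ T₂› χ v μ) = localSplittingCMWith ‹T₂› χ v μ`.  Proof: `T₂ ⊕ᶠ T₁ = diag(t₂ ‖ t₁)` (★
  `UnitaryGroup.finSum_diagonal`), so the rational-frame naturality ★ `frameSection_localSplittingCMWith` gives `frameSection_Q (s_{T₁⊕T₂}) = s_{T₂⊕T₁}`;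
  read on products through ★ `frameOp_toRep_frameSection`, `Q (g ⊕ 1) Q⁻¹ = 1 ⊕ g`, `frameOp_Q (f₂ ⊠ f₁) = f₁ ⊠ f₂` (★ `frameOp_swapQ_boxSB`) and the
  left see-saw for `T₂ ⊕ᶠ T₁`: `f₁ ⊠ ω(s_{T₂} g) f₂ = ω(s_{T₁⊕T₂}(1 ⊕ g))(f₁ ⊠ f₂) = f₁ ⊠ ω(restrictRight (s_{T₁⊕T₂}) g) f₂`; same projection `ι_{T₂}`.

HC_CM is NOT proved here and is proved only modulo the printed citations (2 remaining named inputs hLiu418, h413) until rung 0 closes.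

## References
* [Kudla1994] S. Kudla, Israel J. Math. 87 (1994), §3 Thm. 3.1.
* [Kudla1984] S. Kudla, *Seesaw dual reductive pairs*, Progr. Math. 46 (1984), §1.
* [MoeglinVignerasWaldspurger1987] C. Mœglin, M.-F. Vignéras, J.-L. Waldspurger, LNM 1291 (1987), Chap. 2 II.1 Rem. (6), II Remarque (3).
-/

set_option autoImplicit false

noncomputable section

open scoped Matrix
open NumberField IsDedekindDomain MeasureTheory Matrix
open Literature.RepresentationTheory Literature.RepresentationTheory.HeisenbergGroup
open Literature.NumberTheory.Automorphic Literature.NumberTheory.Automorphic.UnitaryGroup Literature.NumberTheory.Weil1964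
open Literature.NumberTheory.GaloisRepresentations Literature.RepresentationTheory.HarrisKudlaSweet1996

namespace Literature.NumberTheory.GelbartRogawski1991.UnitaryDualPair.LocalSplitting

/-! ## §1 The block swap `Q` between `T₁ ⊕ᶠ T₂` and `T₂ ⊕ᶠ T₁` -/

section Generic

variable (F : Type) [Field F] [NumberField F] (E : Type) [Field E] [NumberField E] [Algebra F E]
  (c : E ≃ₐ[F] E) (v : HeightOneSpectrum (𝓞 F)) (n : ℕ) {T₁ T₂ : Matrix (Fin n) (Fin n) F}
  {J₂ : Matrix (Fin n) (Fin n) E} (hJ₂ : J₂ = T₂.map (algebraMap F E))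
  {J : Matrix (Fin (n + n)) (Fin (n + n)) E} (hJ : J = (UnitaryGroup.finSum n n T₁ T₂).map (algebraMap F E))
  {J' : Matrix (Fin (n + n)) (Fin (n + n)) E} (hJ' : J' = (UnitaryGroup.finSum n n T₂ T₁).map (algebraMap F E))

/-- `submatrix` along an equivalence is multiplicative (three factors). [folklore] -/
private theorem submatrix_mul_mul₃ {R : Type*} [CommRing R] {l m : Type*} [Fintype l] [DecidableEq l] [Fintype m] [DecidableEq m]
    (e : l ≃ m) (A B C : Matrix m m R) :
    (A * B * C).submatrix e e = A.submatrix e e * B.submatrix e e * C.submatrix e e := by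
  rw [Matrix.submatrix_mul_equiv, Matrix.submatrix_mul_equiv]

omit [NumberField F] in
/-- **`Qᵀ · (T₁ ⊕ᶠ T₂) · Q = T₂ ⊕ᶠ T₁`**: the block swap is a rational frame between the two orderings of an orthogonal sum (equal block sizes).
[cite: Kudla1984, §1] [cite: MoeglinVignerasWaldspurger1987, Chap. 2 II Remarque (3)] -/
theorem transpose_swapQ_mul_finSum_mul_swapQ :
    ((swapQ F n : GL (Fin (n + n)) F) : Matrix (Fin (n + n)) (Fin (n + n)) F)ᵀ * UnitaryGroup.finSum n n T₁ T₂ *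
        ((swapQ F n : GL (Fin (n + n)) F) : Matrix (Fin (n + n)) (Fin (n + n)) F) = UnitaryGroup.finSum n n T₂ T₁ := by
  rw [transpose_coe_swapQ, coe_swapQ, UnitaryGroup.finSum, UnitaryGroup.finSum, Matrix.reindex_apply, Matrix.reindex_apply, Matrix.reindex_apply,
    ← submatrix_mul_mul₃, fromBlocks_swap_conj, Matrix.toBlocks_fromBlocks₂₂, Matrix.toBlocks_fromBlocks₂₁, Matrix.toBlocks_fromBlocks₁₂,
    Matrix.toBlocks_fromBlocks₁₁]

/-- the `e₂`-blocks of `(Q h Q⁻¹)_w` are the swapped blocks of `h_w` (any pair of Gram matrices related by `Q`). [cite: Kudla1984, §1] -/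
theorem reindex_coe_frameConj_swapQ' {T T' : Matrix (Fin (n + n)) (Fin (n + n)) F} {K K' : Matrix (Fin (n + n)) (Fin (n + n)) E}
    (hK : K = T.map (algebraMap F E)) (hK' : K' = T'.map (algebraMap F E))
    (hQ : ((swapQ F n : GL (Fin (n + n)) F) : Matrix (Fin (n + n)) (Fin (n + n)) F)ᵀ * T *
      ((swapQ F n : GL (Fin (n + n)) F) : Matrix (Fin (n + n)) (Fin (n + n)) F) = T')
    (h : localPi E c (n + n) K' v) (w : PlacesOver E v) :
    Matrix.reindex (e₂ n).symm (e₂ n).symm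
        (((FrameTransport.frameConj F E c v (n + n) hK hK' (swapQ F n) hQ h : localPi E c (n + n) K v) : LocalGLPi E (n + n) v) w :
          Matrix (Fin (n + n)) (Fin (n + n)) (w.1.adicCompletion E)) =
      Matrix.fromBlocks
        (Matrix.reindex (e₂ n).symm (e₂ n).symm (((h : LocalGLPi E (n + n) v) w : GL (Fin (n + n)) (w.1.adicCompletion E)) :
          Matrix _ _ (w.1.adicCompletion E))).toBlocks₂₂
        (Matrix.reindex (e₂ n).symm (e₂ n).symm (((h : LocalGLPi E (n + n) v) w : GL (Fin (n + n)) (w.1.adicCompletion E)) :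
          Matrix _ _ (w.1.adicCompletion E))).toBlocks₂₁
        (Matrix.reindex (e₂ n).symm (e₂ n).symm (((h : LocalGLPi E (n + n) v) w : GL (Fin (n + n)) (w.1.adicCompletion E)) :
          Matrix _ _ (w.1.adicCompletion E))).toBlocks₁₂
        (Matrix.reindex (e₂ n).symm (e₂ n).symm (((h : LocalGLPi E (n + n) v) w : GL (Fin (n + n)) (w.1.adicCompletion E)) :
          Matrix _ _ (w.1.adicCompletion E))).toBlocks₁₁ := by
  rw [coe_frameConj_apply_apply, Units.val_mul, Units.val_mul, coe_map_swapQ F E v n w, coe_map_swapQ_inv F E v n w, ← fromBlocks_swap_conj]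
  simp only [Matrix.reindex_apply, Equiv.symm_symm, submatrix_mul_mul₃, Matrix.submatrix_submatrix, Equiv.symm_comp_self,
    Matrix.submatrix_id_id]

/-- **`Q (g ⊕ 1) Q⁻¹ = 1 ⊕ g`**: the swap conjugation carries the first-block embedding of `T₂ ⊕ᶠ T₁` to the second-block embedding of
`T₁ ⊕ᶠ T₂` (★ `BlockSum.inlLoc`, ★ `BlockSum.inrLoc`). [cite: Kudla1984, §1] [cite: MoeglinVignerasWaldspurger1987, Chap. 2 II.1 Rem. (6)] -/
theorem frameConj_swapQ_blockSum_inlLoc (g : localPi E c n J₂ v) :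
    FrameTransport.frameConj F E c v (n + n) hJ hJ' (swapQ F n) (transpose_swapQ_mul_finSum_mul_swapQ F n)
        (BlockSum.inlLoc F E c v n n hJ₂ hJ' g) = BlockSum.inrLoc F E c v n n hJ₂ hJ g := by
  refine Subtype.ext (funext fun w => Units.ext ?_)
  apply (Matrix.reindex (e₂ n).symm (e₂ n).symm).injective
  rw [reindex_coe_frameConj_swapQ' F E c v n hJ hJ' _ _ w, BlockSum.inlLoc_apply, BlockSum.inrLoc_apply, UnitaryGroup.coe_reindexGL,
    UnitaryGroup.coe_blockDiagGL, UnitaryGroup.coe_reindexGL, UnitaryGroup.coe_blockDiagGL, Units.val_one]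
  simp only [Matrix.reindex_apply, Matrix.submatrix_submatrix, Equiv.symm_symm, Equiv.symm_comp_self, Matrix.submatrix_id_id,
    Matrix.toBlocks_fromBlocks₁₁, Matrix.toBlocks_fromBlocks₁₂, Matrix.toBlocks_fromBlocks₂₁, Matrix.toBlocks_fromBlocks₂₂]

end Generic

/-! ## §2 The right-block see-saw -/

section CM

variable (L : Type) [Field L] [NumberField L] [IsCMField L] (v : HeightOneSpectrum (𝓞 (maximalRealSubfield L)))
  [MeasurableSpace (v.adicCompletion (maximalRealSubfield L))] [BorelSpace (v.adicCompletion (maximalRealSubfield L))]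
  (μ : Measure (v.adicCompletion (maximalRealSubfield L))) [μ.IsAddHaarMeasure]
  (n : ℕ) {T₁ T₂ : Matrix (Fin n) (Fin n) (maximalRealSubfield L)}

set_option synthInstance.maxHeartbeats 400000 in
set_option maxHeartbeats 8000000 in -- the doubled CM datum's telescope (as in ★ `LocalSplittingCMBlockRestriction`)
/-- **THE RIGHT-BLOCK SEE-SAW FOR KUDLA'S CM SPLITTING** (`T₁ = diag(t₁)`, `T₂ = diag(t₂)` invertible of the same size `n ≥ 1`, every finite place `v`):
the right block restriction of the CM local splitting of `U(T₁ ⊕ᶠ T₂)(L⁺_v)` IS the CM local splitting of `U(T₂)(L⁺_v)`: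
`restrictRight (localSplittingCMWith ‹T₁ ⊕ᶠ T₂› χ v μ) = localSplittingCMWith ‹T₂› χ v μ`.  Proof: the block swap `Q` is a rational frame
`Qᵀ (T₁ ⊕ᶠ T₂) Q = T₂ ⊕ᶠ T₁` onto a DIAGONAL form, so ★ `frameSection_localSplittingCMWith` gives `frameSection_Q (s_{T₁⊕T₂}) = s_{T₂⊕T₁}`; reading
it on products through `Q (g ⊕ 1) Q⁻¹ = 1 ⊕ g` (`frameConj_swapQ_blockSum_inlLoc`) and `frameOp_Q (f₂ ⊠ f₁) = f₁ ⊠ f₂` (★ `frameOp_swapQ_boxSB`) and the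
LEFT see-saw for `T₂ ⊕ᶠ T₁` (★ `restrictLeft_localSplittingCMWith`): `f₁ ⊠ ω(s_{T₂} g) f₂ = ω(s_{T₁⊕T₂}(1 ⊕ g))(f₁ ⊠ f₂) = f₁ ⊠ ω(restrictRight s g) f₂`.
[cite: Kudla1994, §3 Thm. 3.1] [cite: Kudla1984, §1] [cite: MoeglinVignerasWaldspurger1987, Chap. 2 II.1 Rem. (6); II Remarque (3)] -/
theorem restrictRight_localSplittingCMWith (hn : 0 < n) (t₁ t₂ : Fin n → maximalRealSubfield L) (hT₁t : T₁ = Matrix.diagonal t₁)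
    (hT₂t : T₂ = Matrix.diagonal t₂) (hT₁ : T₁.IsSymm) (hT₂ : T₂.IsSymm) (hT₁d : IsUnit T₁.det) (hT₂d : IsUnit T₂.det)
    {J₂ : Matrix (Fin n) (Fin n) L} (hJ₂ : J₂ = T₂.map (algebraMap (maximalRealSubfield L) L))
    {J : Matrix (Fin (n + n)) (Fin (n + n)) L} (hJ : J = (UnitaryGroup.finSum n n T₁ T₂).map (algebraMap (maximalRealSubfield L) L))
    (χ : HeckeCharacter L) (hχ : IsSplittingChar L 1 χ) :
    BlockSum.restrictRight (maximalRealSubfield L) L (IsCMField.complexConj L) v n n hJ₂ hJ (complexConj_imagUnit L) (imagUnit_ne_zero L)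
        (imagUnit_mul_self L) hT₁ hT₂ hT₁d
        (localSplittingCMWith L (n + n) (UnitaryGroup.isSymm_finSum hT₁ hT₂) (DoubledBlock.isUnit_det_finSum L n n hT₁d hT₂d) hJ χ hχ v μ)
        (proj_localSplittingCMWith L (n + n) (UnitaryGroup.isSymm_finSum hT₁ hT₂) (DoubledBlock.isUnit_det_finSum L n n hT₁d hT₂d) hJ χ hχ v μ) =
      localSplittingCMWith L n hT₂ hT₂d hJ₂ χ hχ v μ := by
  haveI : Nontrivial (SchwartzBruhat (Fin n → v.adicCompletion (maximalRealSubfield L))) := nontrivial_schwartzBruhat_pi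
  obtain ⟨f₁, hf₁⟩ := exists_ne (0 : SchwartzBruhat (Fin n → v.adicCompletion (maximalRealSubfield L)))
  -- the swapped sum is diagonal
  have hT' : UnitaryGroup.finSum n n T₂ T₁ = Matrix.diagonal (Fin.append t₂ t₁) := by
    rw [hT₁t, hT₂t, UnitaryGroup.finSum_diagonal]
  -- (S) frame naturality along `Q`: `frameSection_Q (s_{T₁ ⊕ T₂}) = s_{T₂ ⊕ T₁}`
  have hS := frameSection_localSplittingCMWith L v μ (n + n) (Nat.add_pos_left hn n) _ hT'
    (UnitaryGroup.isSymm_finSum hT₁ hT₂) (DoubledBlock.isUnit_det_finSum L n n hT₁d hT₂d)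
    (UnitaryGroup.isSymm_finSum hT₂ hT₁) (DoubledBlock.isUnit_det_finSum L n n hT₂d hT₁d) (swapQ (maximalRealSubfield L) n)
    (transpose_swapQ_mul_finSum_mul_swapQ (maximalRealSubfield L) n) hJ
    (J' := (UnitaryGroup.finSum n n T₂ T₁).map (algebraMap (maximalRealSubfield L) L)) rfl χ hχ
  -- the left see-saw for `T₂ ⊕ T₁`
  have hL := DoubledBlock.restrictLeft_localSplittingCMWith L v μ n n hT₂ hT₁ hT₂d hT₁d hJ₂
    (J := (UnitaryGroup.finSum n n T₂ T₁).map (algebraMap (maximalRealSubfield L) L)) rfl χ hχ hn t₂ hT₂t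
  refine MonoidHom.ext fun g' => MpPsi.ext_of_proj_of_toOp ?_ ?_
  · rw [BlockSum.proj_restrictRight, proj_localSplittingCMWith]
  · refine LinearEquiv.ext fun f₂ => ?_
    change MpPsi.toRep (localSchrodinger (maximalRealSubfield L) n T₂ v)
        (BlockSum.restrictRight (maximalRealSubfield L) L (IsCMField.complexConj L) v n n hJ₂ hJ (complexConj_imagUnit L) (imagUnit_ne_zero L)
          (imagUnit_mul_self L) hT₁ hT₂ hT₁d
          (localSplittingCMWith L (n + n) (UnitaryGroup.isSymm_finSum hT₁ hT₂) (DoubledBlock.isUnit_det_finSum L n n hT₁d hT₂d) hJ χ hχ v μ)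
          (proj_localSplittingCMWith L (n + n) (UnitaryGroup.isSymm_finSum hT₁ hT₂) (DoubledBlock.isUnit_det_finSum L n n hT₁d hT₂d) hJ χ hχ
            v μ) g') f₂ =
      MpPsi.toRep (localSchrodinger (maximalRealSubfield L) n T₂ v) (localSplittingCMWith L n hT₂ hT₂d hJ₂ χ hχ v μ g') f₂
    refine boxSB_right_cancel (v.adicCompletion (maximalRealSubfield L)) (e₂ n) hf₁ ?_
    -- `ω(s_{T₁⊕T₂}(1 ⊕ g'))(f₁ ⊠ f₂) = f₁ ⊠ ω(restrictRight s g') f₂`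
    have h1 := BlockSum.toRep_inrLoc_boxSB (maximalRealSubfield L) L (IsCMField.complexConj L) v n n hJ₂ hJ (complexConj_imagUnit L)
      (imagUnit_ne_zero L) (imagUnit_mul_self L) hT₁ hT₂ hT₁d
      (localSplittingCMWith L (n + n) (UnitaryGroup.isSymm_finSum hT₁ hT₂) (DoubledBlock.isUnit_det_finSum L n n hT₁d hT₂d) hJ χ hχ v μ)
      (proj_localSplittingCMWith L (n + n) (UnitaryGroup.isSymm_finSum hT₁ hT₂) (DoubledBlock.isUnit_det_finSum L n n hT₁d hT₂d) hJ χ hχ v μ)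
      g' f₁ f₂
    -- (S) through `frameOp_Q` at `g' ⊕ 1` and `f₂ ⊠ f₁`
    have h2 := FrameTransport.frameOp_toRep_frameSection (maximalRealSubfield L) L (IsCMField.complexConj L) v (n + n) hJ
      (J' := (UnitaryGroup.finSum n n T₂ T₁).map (algebraMap (maximalRealSubfield L) L)) rfl
      (swapQ (maximalRealSubfield L) n) (transpose_swapQ_mul_finSum_mul_swapQ (maximalRealSubfield L) n)
      (localSplittingCMWith L (n + n) (UnitaryGroup.isSymm_finSum hT₁ hT₂) (DoubledBlock.isUnit_det_finSum L n n hT₁d hT₂d) hJ χ hχ v μ)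
      (BlockSum.inlLoc (maximalRealSubfield L) L (IsCMField.complexConj L) v n n hJ₂ rfl g')
      (boxSB (v.adicCompletion (maximalRealSubfield L)) (e₂ n) f₂ f₁)
    rw [MonoidHom.comp_apply, MonoidHom.comp_apply, hS,
      frameConj_swapQ_blockSum_inlLoc (maximalRealSubfield L) L (IsCMField.complexConj L) v n hJ₂ hJ rfl g'] at h2
    have h2' := h2.trans (congrArg (fun Φ => MpPsi.toRep (localSchrodinger (maximalRealSubfield L) (n + n) (UnitaryGroup.finSum n n T₁ T₂) v)
      (localSplittingCMWith L (n + n) (UnitaryGroup.isSymm_finSum hT₁ hT₂) (DoubledBlock.isUnit_det_finSum L n n hT₁d hT₂d) hJ χ hχ v μ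
        (BlockSum.inrLoc (maximalRealSubfield L) L (IsCMField.complexConj L) v n n hJ₂ hJ g')) Φ)
      (frameOp_swapQ_boxSB (maximalRealSubfield L) v n f₂ f₁))
    -- `ω(s_{T₂⊕T₁}(g' ⊕ 1))(f₂ ⊠ f₁) = ω(s_{T₂} g') f₂ ⊠ f₁` (left see-saw)
    have h3 := BlockSum.toRep_inlLoc_boxSB (maximalRealSubfield L) L (IsCMField.complexConj L) v n n hJ₂
      (J := (UnitaryGroup.finSum n n T₂ T₁).map (algebraMap (maximalRealSubfield L) L)) rfl (complexConj_imagUnit L)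
      (imagUnit_ne_zero L) (imagUnit_mul_self L) hT₂ hT₁ hT₁d
      (localSplittingCMWith L (n + n) (UnitaryGroup.isSymm_finSum hT₂ hT₁) (DoubledBlock.isUnit_det_finSum L n n hT₂d hT₁d) rfl χ hχ v μ)
      (proj_localSplittingCMWith L (n + n) (UnitaryGroup.isSymm_finSum hT₂ hT₁) (DoubledBlock.isUnit_det_finSum L n n hT₂d hT₁d) rfl χ hχ v μ)
      g' f₂ f₁
    rw [hL] at h3
    have h4 := frameOp_swapQ_boxSB (maximalRealSubfield L) v n
      (MpPsi.toRep (localSchrodinger (maximalRealSubfield L) n T₂ v) (localSplittingCMWith L n hT₂ hT₂d hJ₂ χ hχ v μ g') f₂) f₁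
    exact h1.symm.trans (h2'.symm.trans ((congrArg (fun Φ => FrameTransport.frameOp (maximalRealSubfield L) v (n + n)
      (swapQ (maximalRealSubfield L) n) Φ) h3).trans h4))

end CM

end Literature.NumberTheory.GelbartRogawski1991.UnitaryDualPair.LocalSplitting

end
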